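import Literature.NumberTheory.LFunctions.Zhang2022.EllRegimeStatements
import Literature.NumberTheory.LFunctions.Zhang2022.KnifeEdgeEq148DUniform
import Literature.NumberTheory.LFunctions.Zhang2022.Section5ExceptionalZero
import Literature.NumberTheory.LFunctions.ExplicitDeuringHeilbronnDirichlet
import Literature.NumberTheory.LFunctions.ExplicitLogFreeZeroDensityDirichlet
import HarnessLib

/-!
# Zhang (2022) at `P = D^A`, `T = D^B`: the (T)-class floors of §§14–17 made explicit
# (cell `landau-siegel`, family B-ell, registry row E-026 «TFloorsExplicit»; STATEMENTS + the explicit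
# Deuring–Heilbronn width under (A), PROVED from the typed inputs E-008)

Topic `Literature/NumberTheory/LFunctions/Zhang2022` (Landau–Siegel audit tree; verdict-neutral).
Y. Zhang, arXiv:2211.02515v1 (2022) [Zhang2022LandauSiegel] is an unrefereed manuscript under
adjudication; NOTHING here asserts or denies its Theorems 1–2 and nothing here is a claim about
Landau–Siegel zeros.  This file TYPES (defs of kind `Prop` / `ℝ`, no `instance`, no `notation`) the
registry row **E-026** of the cell's `obj/EDREGISTRY.md` v1.7 («T-floors-explicit: the (T)-class polylog
floors of §§14–17 made explicit: `A ≥ A₀^{(T)}` with `A₀^{(T)}` computed from explicit Deuring–Heilbronn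
(E-008: `BGTZ2025.corollary11/12`, `theorem13`) and log-free zero density (E-009:
`thornerZaman2024_theorem12`, `_corollary61`)»; price M (derivation), inputs S; B-ell/EDLIST.md ell-E8)
over the free-scale record `EllScales.Scales` (`KnifeEdgeEllScales.lean`), and PROVES the one piece of
that derivation which is pure bookkeeping over a typed input: the explicit zero-free width for `L(s,χ)`
under (A) from Benli–Goel–Twiss–Zaman's Corollary 1.1.

## What the (T) class is (custodians' analysis, cited, not re-derived)

In print `P = exp 𝓛⁹`, `T = exp 𝓛^{1.1}` (`𝓛 = log D`), so `log P/log D → ∞`, `log T/log D → ∞`, and three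
kinds of step silently use it [ELL-CENSUS v1.0a §1–§3 (theory/ELL-CENSUS.md of the cell, items E2, E5, E7;
"(T)-class floors, constants not in print"); sz-repair-theory g6 #3, channel (T)
(pub/zhang-knife/INBOX.md l.62); zhang-knife-ref FEASIBILITY v1.0b §0.7]:
* (T1) the `O(PT^{−c})` errors ((7.7)–(7.9), (10.2), §14 u010): at `T = D^B` they save `D^{−cB}` —
  no floor in `A` beyond `B > 0`;
* (T5) **Lemma 5.6** (tex l.1579; tree `Skeleton.Lemma56`, PROVED at the pinned scales by
  `Skeleton.lemma56_holds`): `Σ_{p∼P} θ(p)p^{1+it} ≪ 𝔓 exp(−𝓛^{9/2})` for primitive `θ ≠ χ` mod `r < T`,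
  `|t| ≤ D` — consumed by the small-conductor range `1 < r < D³` of (14.8) (tex l.3963; census E5, which
  re-tunes the split to `r < D^{2c}𝓛^{877}` and records the NEED as a saving `𝓛^{−C₅}`, `C₅ ≈ 1715`
  HEURISTIC) and by §7 (7.14), §8 (l.2362); at `log P = A𝓛` the classical zero-free region saves only
  `e^{−c₀A/(k+B)} = O(1)`, so the Deuring–Heilbronn region UNDER (A) is what delivers a polylog saving
  `𝓛^{−κA/(…)}` (g6 #3 (T));
* (T7) the contour shifts "in the same way as in the proof of Lemma 8.2/8.4" (tex l.2392–2420, l.4127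
  «`Dpk/l₂ > T`», l.4217 «`P₄/d > T`», l.4359, l.4662; census E7) past `L(s+β_{j+1},χ)L(s+β_{j+2},χ)/L(s,χ)`,
  which use **Lemma 5.5** (tex l.1567; tree `Skeleton.Lemma55`: under (A), `L(s,χ)` has one simple real zero
  `ρ̃`, `1 − ρ̃ = O(𝓛^{−2022})`, and NO other zero in `σ > 1 − 2𝓛⁻¹`, `|t| < 2D`) and save `x^{−w}` with
  `x > T`, `w` the zero-free width; in print the errors are `O(𝓛^{−15})`, `O(𝓛^{−6})` (Lemma 8.4), so at
  `T = D^B` the NEED is `T^{−w} ≤ 𝓛^{−C₇}`, i.e. a width `w ≥ C₇ log 𝓛/(B𝓛)` (`C₇ = O(10)` HEURISTIC).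
The census's E2 (contour moves `𝔍(±α) → 𝔍(±1)`, Gaussian `ω`) is regime-free apart from the zero count of
`Ψ ∖ Ψ₁`, which the custodians file under channel (Z) (`A₀^{(Z)} ≈ 920`, registry E-020), not here.

## What is typed

§0 The regime predicate is the cell's `EllScales.Scales.IsEllRegime S A B` (`EllRegimeStatements.lean`,
ls-Bell-typer-1; not restated); PROVED: `isEllRegime_scalesAt` (ls-obj-eng-3's constructor
`KnifeEdge.scalesAt A B D` of `KnifeEdgeEq148DUniform.lean` is in the regime) and `isEllRegime_pinned` (the
manuscript's own scales are the regime `A = 𝓛⁸`, `B = 𝓛^{1/10}`).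

§1 The explicit Deuring–Heilbronn width.  `dhK c₁ c₂ c₃ (log q) (log T) = c₁ log q + c₂ log T + c₃` and
`dhWidth c₁ c₂ c₃ c₄ λ (log q) (log T) = log(c₄/(λ·K))/K` — the width of Benli–Goel–Twiss–Zaman's (1.2)
[BenliGoelTwissZaman2025, Cor 1.1] with the factor `1 − β₁` replaced by an upper bound `λ` for it; PROVED:
`repulsionBound_eq` (`BGTZ2025.repulsionBound … β₁ = 1 − dhWidth … (1−β₁) …`, definitional),
`dhWidth_anti` (monotone decreasing in `λ`), `lamA D = (0.72·𝓛^{2022})⁻¹` with `one_sub_lt_lamA`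
((A) + [BenliGoelTwissZaman2025, Lemma 2.9] `0.72(1−β₁) ≤ L(1,χ)` ⇒ `1 − β₁ < λ_A(D)`), the free-scale
twin `ChiZeroFreeAt χ w H` of Lemma 5.5's second half ("every zero of `L(s,χ)` with `Re s > 1 − w`,
`Re s > 1/2`, `|Im s| < H` is the exceptional one"), and the PROVED assembly

  `chiZeroFreeAt_explicit : BGTZ2025.corollary11 → BGTZ2025.lemma29 →`
  `   ForAllLarge (A ⇒ ∀ T ≥ 4, ChiZeroFreeAt χ (dhWidth 10 1 107 (1/16) (λ_A D) 𝓛 (log T)) T)`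

— i.e. under (A), for every height `T ≥ 4`, `L(s,χ)` has no zero other than `ρ̃` in
`Re s > 1 − w_A(D,T)`, `Re s > 1/2`, `|Im s| < T`, with the EXPLICIT
`w_A(D,T) = log( (1/16) / (λ_A(D)·(10𝓛 + log T + 107)) ) / (10𝓛 + log T + 107)`
(`≈ 2021 log 𝓛/((10 + log T/𝓛)𝓛)`).  This is the (T7)-input at free scale, discharged to the two typed
inputs E-008 (named facts, price S) and the tree's unconditional `lemma55_exceptionalZero`.

§2 The NEEDS as free-scale claim shapes (defs of kind `Prop`, no claim): `Lemma56At S χ rExp tExp ϑ`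
(Lemma 5.6 at scale `S` for conductors `r ≤ D^{rExp}`, heights `|t| ≤ D^{tExp}`, with saving FACTOR `ϑ`:
`‖Σ_{p ∈ S.primeWindow} θ(p)p^{1+it}‖ ≤ ϑ·𝔓_S`), with the PROVED pinned bridge `lemma56At_pinned`
(`Skeleton.Lemma56` ⇒ the shape at the manuscript's scales with `ϑ = C·exp(−𝓛^{9/2})`, any `r`-range below
`T`); `chiZeroFreeAt_pinned` (`Skeleton.Lemma55` ⇒ `ChiZeroFreeAt χ (2/𝓛) (2D)`).

§3 Registry row E-026.  `TNeeds` = the record of the polylog powers §§14–17 CONSUME at free scale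
(`rExp`, `tExp5`, `C5` for (T5); `tExp7`, `C7` for (T7)) — PARAMETERS, to be fixed by ls-theory's re-read
of the printed proof (the census marks them "not computable from print"); `TFloorsAt need A B` = «for all
large `D`, under (A), at every `S` in the regime `(A,B)`: (T5) with saving `𝓛^{−C5}` and (T7) with width
`C7·log 𝓛/(B𝓛)` up to height `D^{tExp7}`»; `TFloorsFrom need τ A₀T` = «`TFloorsAt need A (τA)` for every
`A ≥ A₀T`» (designs tie `B = τA`, `τ = 3·10⁻⁴` ordered, `≤ 2·10⁻⁴` print-exact — ELL-CENSUS §1).  The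
HEURISTIC closed forms the explicit inputs suggest — `E7FloorIneq need B : C7·(10 + tExp7) < 2021·B`
(from `w_A ≈ 2021 log 𝓛/((10+tExp7)𝓛)` and the need `w ≥ C7 log 𝓛/(B𝓛)`), `E5FloorIneq need A :
C5·(10(1+rExp) + tExp5) < 2021·A` (same width at modulus `lcm(D,r) ≤ D^{1+rExp}`, via the explicit
formula), and `aZeroT need τ := max(C5(10(1+rExp)+tExp5)/2021, C7(10+tExp7)/(2021τ))` — are DEFINED so
that «`A₀^{(T)} < 920`?» is a one-line numeric check once `need` is fixed.  The (T7) derivation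
(`E7FloorIneq need B →` the (T7) clause of `TFloorsAt`, asymptotics over `chiZeroFreeAt_explicit`) IS in this
file (§5, PROVED, v3); the (T5) derivation (`E5FloorIneq need A →` the (T5) clause, an explicit prime-number
theorem for `θ` under the same width, B-dh's chain, candidate input `thornerZaman2024PNTAP_*`) is NOT in
this file and NOT claimed.  Registry arithmetic of record (HEURISTIC, for orientation only): `τ = 3·10⁻⁴`,
`tExp7 = 1`, `C7 = 15` give `A ≥ 15·11/(2021·3·10⁻⁴) ≈ 272` (exactly `A > 1650000/6063`,
`e7FloorIneq_orientation_iff`); the registry's «≈ 200–350».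

§5 (v3) **The (T7) clause PROVED from E-008 + the floor inequality.**  `dhWidth_eventually_ge`: with
`L = log D`, for `t > 0`, `B > 0` and `C·(10 + t) < 2021·B` there is `L₀` with
`C·log L/(B·L) ≤ dhWidth 10 1 107 (1/16) ((0.72 L^2022)⁻¹) L (t·L)` for all `L ≥ L₀` (the explicit width at
height `D^t` is `log(0.045·L^2022/(aL + 107))/(aL + 107) ≥ (2021 log L − c₀)/(aL + 107)`, `a = 10 + t`,
`c₀ = log((a + 107)/0.045)`, and `(2021B − Ca)·L log L` eventually beats `Bc₀·L + 107|C|·log L`);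
`ChiZeroFreeAt.mono` (narrower region, lower height); hence `chiZeroFreeAt_T7_of_e7FloorIneq :
BGTZ2025.corollary11 → BGTZ2025.lemma29 → 0 < B → 0 < tExp7 → E7FloorIneq need B →
ForAllLarge((A) ⇒ ChiZeroFreeAt χ (C7·log 𝓛/(B𝓛)) (D^{tExp7}))` — the (T7) conjunct of `TFloorsAt need A B`
for EVERY `A`; `tFloorsAt_of_e7FloorIneq` / `tFloorsFrom_of_e7FloorIneq` (E-026 at `(A,B)`, resp. along
`B = τA` from `A₀T` with `E7FloorIneq need (τ·A₀T)`, GIVEN only the (T5) half as a hypothesis);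
`e7FloorIneq_mono` (monotone in `B`).  Registry reading: E-026 = (T5)-half ∧ (T7)-half, and the (T7)-half is
a kernel theorem modulo E-008 (theorem-in-print, typed) and the numeric `E7FloorIneq` — what remains «derivation»
is the (T5)-half and ls-theory's values of `TNeeds`.

§4 Registry rows E-019 / E-023 / E-024 (the PRINTED (14.8) at fixed `(A,B)`, over ls-obj-eng-3's free-scale
§14 objects `KnifeEdge.rhs1417OnAt`, `largeConductorRange`, `Eq142At`, `scalesAt` of
`KnifeEdgeEq148DUniform.lean`, cited not restated): `Eq148PrintedFixedA A B` = the census's RECONSTRUCTED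
exponent of the printed large-sieve bound on the large-conductor range — `≤ C·P²·D^{1/2−B+ε}` for every
`ε > 0` (ELL-CENSUS §2 E4: block bound `D^{2A+1/2−B}` against the target `D^{2A−c}`; polylogs and `1/𝔞` absorbed
in `ε`; status «derivation, census-reconstructed, ls-theory countersign requested», price M → S); PROVED
bookkeeping `eq148DUniform_of_printedFixedA` («`B > 1/2` ⇒ exponent `< 0`»: `Eq148PrintedFixedA A B` with
`B > 1/2` gives E-016 `KnifeEdge.Eq148DUniform A B` with `c = (B − 1/2)/2`), i.e. on the `B > 1/2` sheet E-016 is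
not an extra input; `E8RankinRetune B γ` (E-023: the re-tuned Rankin cutoff exponent `0 < γ < B`) and
`E5SplitRetune c need` (E-024: the re-tuned split `rExp = 2c` feeding `TNeeds.rExp`) — one-line bookkeeping
definitions, no floor in `A`.

Deliberately NOT here: E-016 itself (`KnifeEdge.Eq148DUniform`, ls-obj-eng-3), E-020/E-022/E-027
(`EllRegimeStatements.lean`, ls-Bell-typer-1), every numerical value of record.

## References
* Y. Zhang, arXiv:2211.02515v1 (2022), §5 Lemmas 5.5–5.6 (tex l.1567–1583), §7 (7.14), §8 Lemma 8.4
  (l.2392–2420), §14 (14.8) (l.3945–3964), §15 (l.4127, l.4217, l.4359), §16 (l.4662).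
  [Zhang2022LandauSiegel]
* S. Benli, S. Goel, H. Twiss, A. Zaman, Proc. AMS (2025), doi:10.1090/proc/17450, arXiv:2410.06082,
  Corollary 1.1 (1.2), Lemma 2.9. [BenliGoelTwissZaman2025]
* J. Thorner, A. Zaman, Forum Math. 36 (2024), arXiv:2208.11123, Theorem 1.2. [ThornerZaman2024LogFree]

«The programme SEARCHES and TYPES; no claim about Landau–Siegel zeros, Theorems 1–2 of arXiv:2211.02515 or
a repaired Margin232 until a kernel theorem says so.»
-/

noncomputable section

open Complex Real ComplexConjugate

namespace Literature.NumberTheory.LFunctions.Zhang2022.EllRegime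

open EllScales Skeleton

/-! ## §0 The regime `P = D^A`, `T = D^B` (polylog scales pinned as in print) -/

/-- The regime predicate is the cell's `EllScales.Scales.IsEllRegime S A B` (`EllRegimeStatements.lean`,
ls-Bell-typer-1: `log P = A·log D`, `log T = B·log D`, `t₀, 𝓛₁, 𝓛₂, η` pinned); ls-obj-eng-3's constructor
`KnifeEdge.scalesAt A B D` (`KnifeEdgeEq148DUniform.lean`) lands in it (PROVED, definitional).
[cite: Zhang2022LandauSiegel, §2 (2.6), (2.8), (2.15); §6] -/
theorem isEllRegime_scalesAt (A B : ℝ) (D : ℕ) : (KnifeEdge.scalesAt A B D).IsEllRegime A B :=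
  ⟨⟨rfl, rfl, rfl, rfl, rfl⟩, rfl⟩

/-- The manuscript's pinned scales are the regime `A = 𝓛⁸`, `B = 𝓛^{1/10}` (`log P = 𝓛⁹ = 𝓛⁸·𝓛`,
`log T = 𝓛^{1.1} = 𝓛^{1/10}·𝓛`), for `log D > 0` (PROVED). [cite: Zhang2022LandauSiegel, §2 (2.6); §6] -/
theorem isEllRegime_pinned {D : ℕ} (hD : 0 < Real.log D) :
    (Scales.pinned D).IsEllRegime (Real.log D ^ 8) (Real.log D ^ (1 / 10 : ℝ)) := by
  refine ⟨⟨?_, rfl, rfl, rfl, rfl⟩, ?_⟩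
  · show Real.log D ^ 9 = Real.log D ^ 8 * Real.log D
    ring
  · show Real.log D ^ (1.1 : ℝ) = Real.log D ^ (1 / 10 : ℝ) * Real.log D
    have h : (1.1 : ℝ) = 1 / 10 + 1 := by norm_num
    rw [h, Real.rpow_add hD, Real.rpow_one]

/-! ## §1 The explicit Deuring–Heilbronn width under (A) -/

/-- `K(q,T) = c₁ log q + c₂ log T + c₃` — the denominator of [BenliGoelTwissZaman2025, (1.2)].
[cite: BenliGoelTwissZaman2025, Corollary 1.1 (1.2)] -/
def dhK (c₁ c₂ c₃ logq logT : ℝ) : ℝ := c₁ * logq + c₂ * logT + c₃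

/-- **The explicit Deuring–Heilbronn width** `log(c₄/(λ·K))/K`, `K = c₁ log q + c₂ log T + c₃`: the
width of the zero-free region of (1.2) when the exceptional zero satisfies `1 − β₁ ≤ λ`.
[cite: BenliGoelTwissZaman2025, Corollary 1.1 (1.2)] -/
def dhWidth (c₁ c₂ c₃ c₄ lam logq logT : ℝ) : ℝ :=
  Real.log (c₄ / (lam * dhK c₁ c₂ c₃ logq logT)) / dhK c₁ c₂ c₃ logq logT

/-- The tree's `BGTZ2025.repulsionBound` is `1 − dhWidth` at `λ = 1 − β₁` (definitional).
[cite: BenliGoelTwissZaman2025, Corollary 1.1 (1.2)] -/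
theorem repulsionBound_eq (c₁ c₂ c₃ c₄ : ℝ) (q : ℕ) (T β₁ : ℝ) :
    BGTZ2025.repulsionBound c₁ c₂ c₃ c₄ q T β₁ =
      1 - dhWidth c₁ c₂ c₃ c₄ (1 - β₁) (Real.log q) (Real.log T) := rfl

/-- The width is monotone decreasing in the bound `λ` for `1 − β₁` (a zero closer to `1` repels more).
[cite: BenliGoelTwissZaman2025, Corollary 1.1 (1.2)] -/
theorem dhWidth_anti {c₁ c₂ c₃ c₄ lam lam' logq logT : ℝ} (hK : 0 < dhK c₁ c₂ c₃ logq logT)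
    (hc₄ : 0 < c₄) (hlam : 0 < lam) (h : lam ≤ lam') :
    dhWidth c₁ c₂ c₃ c₄ lam' logq logT ≤ dhWidth c₁ c₂ c₃ c₄ lam logq logT := by
  have hlam' : 0 < lam' := lt_of_lt_of_le hlam h
  unfold dhWidth
  apply div_le_div_of_nonneg_right _ hK.le
  apply Real.log_le_log (by positivity)
  exact div_le_div_of_nonneg_left hc₄.le (by positivity) (mul_le_mul_of_nonneg_right h hK.le)

/-- **`λ_A(D) = (0.72·𝓛^{2022})⁻¹`** — the bound for `1 − β₁` that Assumption (A) (`L(1,χ) < 𝓛^{−2022}`)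
gives through [BenliGoelTwissZaman2025, Lemma 2.9] (`0.72(1 − β₁) ≤ L(1,χ)`).
[cite: BenliGoelTwissZaman2025, Lemma 2.9] [cite: Zhang2022LandauSiegel, §1 (A)] -/
def lamA (D : ℕ) : ℝ := (0.72 * Real.log D ^ 2022)⁻¹

/-- Under (A), BGTZ's Lemma 2.9 gives `1 − β₁ < λ_A(D)` for the exceptional zero `β₁` of the real
primitive `χ` mod `D > 4·10⁵` (in BGTZ's range `β₁ > 1 − 1/(10 log D)`).
[cite: BenliGoelTwissZaman2025, Lemma 2.9] [cite: Zhang2022LandauSiegel, §1 (A)] -/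
theorem one_sub_lt_lamA (h29 : BGTZ2025.lemma29) {D : ℕ} [NeZero D] (hD : 400000 < D)
    (χ : DirichletCharacter ℂ D) (hq : χ.IsQuadratic) (hχ : χ ≠ 1) (hA : AssumptionA D χ)
    {β₁ : ℝ} (h1 : 1 - 1 / (10 * Real.log D) < β₁) (h2 : β₁ < 1) (hz : χ.LFunction β₁ = 0) :
    1 - β₁ < lamA D := by
  obtain ⟨hlo, -⟩ := h29 D hD χ hq hχ β₁ h1 h2 hz
  have hD1 : (1 : ℝ) < D := by exact_mod_cast (show 1 < D by omega)
  have hlog : 0 < Real.log D := Real.log_pos hD1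
  have hL : 0 < Real.log D ^ 2022 := by positivity
  have hA' : ‖χ.LFunction 1‖ < 1 / Real.log D ^ 2022 := hA
  have hlt : 0.72 * (1 - β₁) < 1 / Real.log D ^ 2022 :=
    lt_of_le_of_lt (hlo.trans (Complex.re_le_norm _)) hA'
  have h' : 0.72 * (1 - β₁) * Real.log D ^ 2022 < 1 := (lt_div_iff₀ hL).mp hlt
  rw [lamA, ← one_div, lt_div_iff₀ (by positivity)]
  calc (1 - β₁) * (0.72 * Real.log D ^ 2022) = 0.72 * (1 - β₁) * Real.log D ^ 2022 := by ring
    _ < 1 := h'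

/-- **Free-scale twin of Lemma 5.5 (second half).**  `ChiZeroFreeAt χ w H`: `L(s,χ)` has a real zero
`ρ̃` such that EVERY zero `s` with `Re s > 1 − w`, `Re s > 1/2` and `|Im s| < H` equals `ρ̃` — Zhang's
"`L(s,χ)` has no other zeros in the region `σ > 1 − 2𝓛⁻¹`, `|t| < 2D`" with `(2𝓛⁻¹, 2D)` replaced by free
`(w, H)` (the clause `Re s > 1/2`, automatic in print, keeps the region inside the scope of the explicit
repulsion theorems).  A claim SHAPE (def of kind `Prop`). [cite: Zhang2022LandauSiegel, §5 Lemma 5.5] -/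
def ChiZeroFreeAt {D : ℕ} [NeZero D] (χ : DirichletCharacter ℂ D) (w H : ℝ) : Prop :=
  ∃ ρt : ℝ, χ.LFunction ρt = 0 ∧
    ∀ s : ℂ, χ.LFunction s = 0 → 1 - w < s.re → 1 / 2 < s.re → |s.im| < H → s = ρt

/-- Explicit repulsion for the modulus `D` at height `T`, an exceptional zero `β₁` of `χ` in BGTZ's
range with `1 − β₁ ≤ λ`, and `K > 0`, `c₄ > 0` give `ChiZeroFreeAt χ (dhWidth … λ …) T`
(PROVED bookkeeping over the shape `BGTZ2025.Repulsion`).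
[cite: BenliGoelTwissZaman2025, Corollary 1.1 (1.2)] [cite: Zhang2022LandauSiegel, §5 Lemma 5.5] -/
theorem chiZeroFreeAt_of_repulsion {D : ℕ} [NeZero D] (χ : DirichletCharacter ℂ D) (hχ : χ ≠ 1)
    {c₁ c₂ c₃ c₄ T lam : ℝ} (hR : BGTZ2025.Repulsion c₁ c₂ c₃ c₄ D T)
    (hK : 0 < dhK c₁ c₂ c₃ (Real.log D) (Real.log T)) (hc₄ : 0 < c₄)
    {β₁ : ℝ} (h1 : 1 - 1 / (10 * Real.log D) < β₁) (h2 : β₁ < 1) (hz : χ.LFunction β₁ = 0)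
    (hlam : 1 - β₁ ≤ lam) :
    ChiZeroFreeAt χ (dhWidth c₁ c₂ c₃ c₄ lam (Real.log D) (Real.log T)) T := by
  refine ⟨β₁, hz, fun s hs hre hhalf him => ?_⟩
  by_contra hne
  have hs1 : s ≠ 1 := by
    rintro rfl
    exact DirichletCharacter.LFunction_apply_one_ne_zero hχ hs
  have hlt := hR χ β₁ h1 h2 hz χ s hs1 hne hs hhalf him.le
  rw [repulsionBound_eq] at hlt
  have hanti := dhWidth_anti (c₄ := c₄) hK hc₄ (by linarith) hlam
  linarith

/-- **The (T7)-input at free scale, discharged to E-008 (PROVED).**  From BGTZ's Corollary 1.1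
(`BGTZ2025.corollary11`, registry E-008) and Lemma 2.9 (`BGTZ2025.lemma29`), both typed named facts
(price S), and the tree's unconditional `lemma55_exceptionalZero`: for all large `D`, every real primitive
`χ` mod `D` satisfying (A) and every height `T ≥ 4`, `L(s,χ)` has no zero other than its exceptional one in
`Re s > 1 − w_A(D,T)`, `Re s > 1/2`, `|Im s| < T`, with the EXPLICIT width
`w_A(D,T) = dhWidth 10 1 107 (1/16) (λ_A D) (log D) (log T) = log((1/16)/(λ_A(D)(10𝓛 + log T + 107)))/(10𝓛 + log T + 107)`.
At `T = D^B` this is `≈ 2021 log 𝓛/((10 + B)𝓛)`, against Zhang's `2/𝓛` (Lemma 5.5, pinned `T`).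
[cite: BenliGoelTwissZaman2025, Corollary 1.1, Lemma 2.9] [cite: Zhang2022LandauSiegel, §5 Lemma 5.5] -/
theorem chiZeroFreeAt_explicit (h11 : BGTZ2025.corollary11) (h29 : BGTZ2025.lemma29) :
    ForAllLarge fun D _ χ => AssumptionA D χ → ∀ T : ℝ, 4 ≤ T →
      ChiZeroFreeAt χ (dhWidth 10 1 107 (1 / 16) (lamA D) (Real.log D) (Real.log T)) T := by
  obtain ⟨D₀, K, hK, c, -, H⟩ := lemma55_exceptionalZero
  refine ⟨max (max D₀ 400001) ⌈Real.exp (10 * K + 1)⌉₊, fun D _ χ hD hq hp hA T hT => ?_⟩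
  have hD₀ : D₀ ≤ D := le_trans (le_trans (le_max_left _ _) (le_max_left _ _)) hD
  have h4e5 : 400000 < D :=
    lt_of_lt_of_le (by norm_num) (le_trans (le_trans (le_max_right _ _) (le_max_left _ _)) hD)
  have hexp : ⌈Real.exp (10 * K + 1)⌉₊ ≤ D := le_trans (le_max_right _ _) hD
  have hDpos : (0 : ℝ) < D := by exact_mod_cast (show 0 < D by omega)
  have hlogD : 10 * K + 1 ≤ Real.log D := by
    have h : Real.exp (10 * K + 1) ≤ D := le_trans (Nat.le_ceil _) (by exact_mod_cast hexp)
    exact (Real.le_log_iff_exp_le hDpos).mpr h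
  have hlogpos : 0 < Real.log D := by linarith
  have hχ1 : χ ≠ 1 := ne_one_of_isPrimitive_of_three_le hp (by omega)
  have hA' : ‖χ.LFunction 1‖ < (Real.log D ^ 2022)⁻¹ := by
    have h := hA
    rw [AssumptionA, one_div] at h
    exact h
  obtain ⟨β₁, hβ1, hz, -, -, hKb, -, -, -⟩ := H D hD₀ χ hχ1 hA'
  -- `β₁` lies in BGTZ's range `β₁ > 1 − 1/(10 log D)`: `K 𝓛^{−2022} < 1/(10𝓛)` since `𝓛 ≥ 10K + 1`
  have hrange : 1 - 1 / (10 * Real.log D) < β₁ := by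
    have hL1 : 1 ≤ Real.log D := by linarith
    have hpow : Real.log D ≤ Real.log D ^ 2021 := le_self_pow₀ hL1 (by norm_num)
    have hlt : 10 * K < Real.log D ^ 2021 := by linarith
    have hkey : K * (Real.log D ^ 2022)⁻¹ < 1 / (10 * Real.log D) := by
      rw [← one_div, mul_one_div, div_lt_div_iff₀ (by positivity) (by positivity)]
      calc K * (10 * Real.log D) = 10 * K * Real.log D := by ring
        _ < Real.log D ^ 2021 * Real.log D := by gcongr
        _ = 1 * Real.log D ^ 2022 := by ring
    linarith
  have hlam : 1 - β₁ < lamA D := one_sub_lt_lamA h29 h4e5 χ hq hχ1 hA hrange hβ1 hz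
  have hT0 : 0 < Real.log T := Real.log_pos (by linarith)
  have hKpos : 0 < dhK 10 1 107 (Real.log D) (Real.log T) := by
    unfold dhK; positivity
  exact chiZeroFreeAt_of_repulsion χ hχ1 (h11 D h4e5 T hT) hKpos (by norm_num) hrange hβ1 hz hlam.le

/-! ## §2 The needs, as free-scale claim shapes -/

/-- **Free-scale twin of Lemma 5.6 with an explicit saving factor.**  `Lemma56At S χ rExp tExp ϑ`:
at scale `S`, for every primitive `θ` mod `r`, `1 < r ≤ D^{rExp}`, with `θ ≠ χ` as characters mod `Dr`,
and every `|t| ≤ D^{tExp}`: `‖Σ_{p ∈ S.primeWindow} θ(p) p^{1+it}‖ ≤ ϑ · 𝔓_S` (Zhang: `r < T`, `|t| ≤ D`,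
`ϑ = C·exp(−𝓛^{9/2})`; census E5 needs `r ≤ D^{2c}𝓛^{877}` re-tuned / `D³` as printed, and `ϑ = 𝓛^{−C₅}`).
A claim SHAPE (def of kind `Prop`); `D` is the modulus of `χ`.
[cite: Zhang2022LandauSiegel, §5 Lemma 5.6; §14 (14.8) proof p.79] -/
def Lemma56At (S : Scales) {D : ℕ} [NeZero D] (χ : DirichletCharacter ℂ D) (rExp tExp ϑ : ℝ) : Prop :=
  ∀ (r : ℕ) [NeZero r], 1 < r → (r : ℝ) ≤ (D : ℝ) ^ rExp →
    ∀ θ : DirichletCharacter ℂ r, θ.IsPrimitive →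
      DirichletCharacter.changeLevel (Nat.dvd_mul_left r D) θ ≠
        DirichletCharacter.changeLevel (Nat.dvd_mul_right D r) χ →
      ∀ t : ℝ, |t| ≤ (D : ℝ) ^ tExp →
        ‖∑ p ∈ S.primeWindow, θ p * (p : ℂ) ^ (1 + t * I)‖ ≤ ϑ * S.frakP

/-- **Pinned bridge (PROVED).**  Zhang's Lemma 5.6 (`Skeleton.Lemma56`, a theorem of the tree via
`Skeleton.lemma56_holds`) gives the shape at the manuscript's scales with `ϑ = C·exp(−𝓛^{9/2})`, heights
`|t| ≤ D`, and any conductor range `D^{rExp}` below `T = exp 𝓛^{1.1}`.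
[cite: Zhang2022LandauSiegel, §5 Lemma 5.6] -/
theorem lemma56At_pinned (h : Skeleton.Lemma56) :
    ∃ C : ℝ, ForAllLarge fun D _ χ => AssumptionA D χ → ∀ rExp : ℝ, (D : ℝ) ^ rExp < bigT D →
      Lemma56At (Scales.pinned D) χ rExp 1 (C * Real.exp (-(ell D ^ ((9 : ℝ) / 2)))) := by
  obtain ⟨C, D₀, hC⟩ := h
  refine ⟨C, D₀, fun D _ χ hD hq hp hA rExp hT r _ hr hrD θ hθ hne t ht => ?_⟩
  have hrT : (r : ℝ) < bigT D := lt_of_le_of_lt hrD hT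
  have ht' : |t| ≤ D := by simpa using ht
  have key := hC D χ hD hq hp hA r hr hrT θ hθ hne t ht'
  rw [Scales.pinned_primeWindow, Scales.pinned_frakP]
  calc _ ≤ C * Zhang2022.frakP D * Real.exp (-(ell D ^ ((9 : ℝ) / 2))) := key
    _ = C * Real.exp (-(ell D ^ ((9 : ℝ) / 2))) * Zhang2022.frakP D := by ring

/-- **Pinned bridge (PROVED).**  Zhang's Lemma 5.5 (`Skeleton.Lemma55`) gives `ChiZeroFreeAt χ (2/𝓛) (2D)`
for all large `D` under (A). [cite: Zhang2022LandauSiegel, §5 Lemma 5.5] -/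
theorem chiZeroFreeAt_pinned (h : Skeleton.Lemma55) :
    ForAllLarge fun D _ χ => AssumptionA D χ → ChiZeroFreeAt χ (2 / ell D) (2 * D) := by
  obtain ⟨C, D₀, hC⟩ := h
  refine ⟨D₀, fun D _ χ hD hq hp hA => ?_⟩
  obtain ⟨ρt, hz, -, -, -, huniq⟩ := hC D χ hD hq hp hA
  exact ⟨ρt, hz, fun s hs hre _ him => huniq s hs hre him⟩

/-! ## §3 Registry row E-026 «TFloorsExplicit» -/

/-- **What the (T)-class steps CONSUME at free scale** — parameters, to be fixed by the custodians'
re-read of the printed proof (ELL-CENSUS §2 marks the constants "not computable from print"):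
* `rExp`  — conductor exponent of the small range of (14.8) handled by Lemma 5.6: `r ≤ D^{rExp}`
  (printed `D³`; census E5 re-tune `D^{2c}𝓛^{877}`, i.e. `rExp = 2c + o(1)`);
* `tExp5` — height exponent in Lemma 5.6 (`|t| ≤ D`: `1` as printed);
* `C5`    — the polylog power the small range must save: `ϑ = 𝓛^{−C5}` (census E5: `≈ 1715`, HEURISTIC);
* `tExp7` — height exponent of the `L(s,χ)` zero-free region the shifts use (`|t| < 2D`: `≈ 1`);
* `C7`    — the polylog power the shifts must save, `T^{−w} ≤ 𝓛^{−C7}` (Lemma 8.4: errors `O(𝓛^{−15})`,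
  `O(𝓛^{−6})`; census E7: `O(1)`, HEURISTIC).
[cite: Zhang2022LandauSiegel, §5 Lemmas 5.5–5.6; §8 Lemma 8.4; §14 (14.8) proof] -/
structure TNeeds where
  /-- conductor exponent of Lemma 5.6's range -/
  rExp : ℝ
  /-- height exponent in Lemma 5.6 -/
  tExp5 : ℝ
  /-- polylog power Lemma 5.6 must save -/
  C5 : ℝ
  /-- height exponent of the `L(s,χ)` zero-free region -/
  tExp7 : ℝ
  /-- polylog power the contour shifts must save -/
  C7 : ℝ

/-- **E-026 at one regime point `(A,B)`** (registry row «T-floors-explicit», B-ell/EDLIST ell-E8): for all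
large `D` and every real primitive `χ` mod `D` with (A), at every free-scale record `S` over `D` in the
regime `(A,B)`: (T5) Lemma 5.6 holds on `r ≤ D^{rExp}`, `|t| ≤ D^{tExp5}` with saving `𝓛^{−C5}`, and (T7)
`L(s,χ)` is free of non-exceptional zeros in `Re s > 1 − C7·log 𝓛/(B𝓛)`, `Re s > 1/2`, `|Im s| < D^{tExp7}`
(so that `x^{−w} ≤ T^{−w} ≤ 𝓛^{−C7}` for `x > T = D^B`).  ((T1), the `O(PT^{−c})` errors, need only
`B > 0` and are not listed.)  A NAMED OPEN STATEMENT (def of kind `Prop`; status «derivation», price M,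
inputs E-008/E-009 S); its (T7) clause is implied for large `D` by `chiZeroFreeAt_explicit` whenever
`E7FloorIneq need B`, `B > 0`, `tExp7 > 0` — PROVED, `chiZeroFreeAt_T7_of_e7FloorIneq` (§5).
[cite: Zhang2022LandauSiegel, §5 Lemmas 5.5–5.6; §14 (14.8) proof p.79] -/
def TFloorsAt (need : TNeeds) (A B : ℝ) : Prop :=
  ForAllLarge fun D _ χ => AssumptionA D χ → ∀ S : Scales, S.D = D → S.IsEllRegime A B →
    Lemma56At S χ need.rExp need.tExp5 (Real.log D ^ (-need.C5)) ∧
      ChiZeroFreeAt χ (need.C7 * Real.log (Real.log D) / (B * Real.log D)) ((D : ℝ) ^ need.tExp7)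

/-- **E-026 as a floor** («`A ≥ A₀^{(T)}` ⇒ the (T)-class floors are met»): along the design tie
`B = τ·A` (`τ = B/A`: ordered `3·10⁻⁴`, print-exact `≤ 2·10⁻⁴`, ELL-CENSUS §1), `TFloorsAt` holds at every
`A ≥ A₀T`.  «B free» designs use `TFloorsAt` directly.  Named open statement.
[cite: Zhang2022LandauSiegel, §2 (2.21); §6; §14 (14.8) proof p.79] -/
def TFloorsFrom (need : TNeeds) (τ A₀T : ℝ) : Prop :=
  ∀ A : ℝ, A₀T ≤ A → TFloorsAt need A (τ * A)

/-- **HEURISTIC closed form, (T7).**  `w_A(D, D^B) ≈ 2021·log 𝓛/((10 + tExp7)𝓛)` (§1) against the need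
`w ≥ C7·log 𝓛/(B𝓛)`: the floor inequality `C7·(10 + tExp7) < 2021·B`.  DEFINED for the registry's one-line
numeric check; the implication `E7FloorIneq need B →` (T7)-clause of `TFloorsAt need A B` (from
`chiZeroFreeAt_explicit`, for `B > 0`, `tExp7 > 0`) is PROVED in §5 (`chiZeroFreeAt_T7_of_e7FloorIneq`).
[cite: BenliGoelTwissZaman2025, Corollary 1.1] [cite: Zhang2022LandauSiegel, §8 Lemma 8.4] -/
def E7FloorIneq (need : TNeeds) (B : ℝ) : Prop := need.C7 * (10 + need.tExp7) < 2021 * B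

/-- **HEURISTIC closed form, (T5).**  The same explicit width at modulus `lcm(D,r) ≤ D^{1+rExp}` and height
`D^{tExp5}` gives, through the explicit formula, a saving `P^{−w} ≈ 𝓛^{−2021·A/(10(1+rExp)+tExp5)}`
against the need `𝓛^{−C5}`: the floor inequality `C5·(10(1 + rExp) + tExp5) < 2021·A`.  DEFINED for
orientation; its derivation (an explicit prime-number theorem for `θ` under (A); B-dh's chain) is NOT in
this file and NOT claimed. [cite: BenliGoelTwissZaman2025, Corollary 1.1] [cite: Zhang2022LandauSiegel, §5 Lemma 5.6] -/
def E5FloorIneq (need : TNeeds) (A : ℝ) : Prop :=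
  need.C5 * (10 * (1 + need.rExp) + need.tExp5) < 2021 * A

/-- **HEURISTIC `A₀^{(T)}(need, τ)`** — the least `A` beyond which both closed-form floors hold along
`B = τA`: `max( C5(10(1+rExp)+tExp5)/2021 , C7(10+tExp7)/(2021τ) )`.  (Registry arithmetic: `τ = 3·10⁻⁴`,
`tExp7 = 1`, `C7 = 15` give `≈ 272`; «≈ 200–350».)  For orientation only; see `E5FloorIneq`, `E7FloorIneq`.
[cite: Zhang2022LandauSiegel, §2 (2.21); §6] [cite: BenliGoelTwissZaman2025, Corollary 1.1] -/
def aZeroT (need : TNeeds) (τ : ℝ) : ℝ :=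
  max (need.C5 * (10 * (1 + need.rExp) + need.tExp5) / 2021)
    (need.C7 * (10 + need.tExp7) / (2021 * τ))

/-- Above the heuristic threshold both closed-form floor inequalities hold (for `τ > 0`; PROVED
arithmetic). [cite: Zhang2022LandauSiegel, §2 (2.21); §6] -/
theorem floorIneqs_of_aZeroT_lt (need : TNeeds) {τ A : ℝ} (hτ : 0 < τ) (hA : aZeroT need τ < A) :
    E5FloorIneq need A ∧ E7FloorIneq need (τ * A) := by
  have h5 : need.C5 * (10 * (1 + need.rExp) + need.tExp5) / 2021 < A :=
    lt_of_le_of_lt (le_max_left _ _) hA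
  have h7 : need.C7 * (10 + need.tExp7) / (2021 * τ) < A :=
    lt_of_le_of_lt (le_max_right _ _) hA
  constructor
  · unfold E5FloorIneq
    rw [div_lt_iff₀ (by norm_num)] at h5
    linarith
  · unfold E7FloorIneq
    rw [div_lt_iff₀ (by positivity)] at h7
    linarith

/-! ## §4 Registry rows E-019 / E-023 / E-024: the printed (14.8) at fixed `(A,B)` -/

section Printed148

open KnifeEdge Typed.Sec14

/-- **E-019 «Eq148PrintedFixedA» (alias ell-E2; the E4-window).**  At the scales `P = D^A`, `T = D^B` (others
pinned): for every implied constant `Bτ` of (14.1)–(14.2) and every `ε > 0` there is `C` such that, for all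
large `D`, every real primitive `χ (mod D)` with (A), and all `𝐤*`, `𝐚*` with (14.1), (14.2): the u017 majorant
of (14.8) on the large-conductor range `D³ ≤ r < 2DP₄` is `≤ C·P²·D^{1/2−B+ε}`.  This is what the PRINTED
argument («Mellin transform, Lemma 5.4 (i) and the large sieve inequality», p.79) yields at free scales
according to the custodians' census (ELL-CENSUS v1.0a §2 E4, exponents RECONSTRUCTED from tex l.3905–3964: block
bound `D^{2A+1/2−B}` against the target `D^{2A−c}`, i.e. relative size `D^{1/2−B+o(1)}/𝔞`; the `ℒ^{O(1)}` and
`1/𝔞` are absorbed in `ε`).  A NAMED DERIVATION TARGET (def of kind `Prop`; status «derivation», price M, S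
once ls-theory countersigns the census line by line); asserted by no one; the manuscript proves (14.8) only at
`log T = 𝓛^{1.1}` where the loss `D^{1/2}T^{−1}` is invisible. [cite: Zhang2022LandauSiegel, §14 (14.8) (proof) p.79, tex L3945–L3964] -/
def Eq148PrintedFixedA (A B : ℝ) : Prop :=
  ∀ Bτ : ℝ, ∀ ε : ℝ, 0 < ε → ∃ C : ℝ, ForAllLarge fun D _ χ => AssumptionA D χ →
    ∀ κs as : ℕ → ℂ, Eq141 Bτ κs → Eq142At (scalesAt A B D) Bτ as →
      rhs1417OnAt χ (scalesAt A B D) κs (largeConductorRange (scalesAt A B D) D)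
        ≤ C * (scalesAt A B D).P ^ 2 * (D : ℝ) ^ (1 / 2 - B + ε)

/-- **«`B > 1/2` ⇒ exponent `< 0`» (PROVED bookkeeping).**  On the sheet `B > 1/2` the reconstructed printed
bound IS the needed estimate: `Eq148PrintedFixedA A B` gives E-016 `KnifeEdge.Eq148DUniform A B` (with
`c = (B − 1/2)/2`, `ε = (B − 1/2)/2`).  So E-016 is an extra input only for designs with `B ≤ 1/2`
(`A ≤ 1667` at `B = 3·10⁻⁴A`, `A ≤ 2500` print-exact; ELL-CENSUS §3).
[cite: Zhang2022LandauSiegel, §14 (14.8) (proof) p.79] -/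
theorem eq148DUniform_of_printedFixedA {A B : ℝ} (hB : 1 / 2 < B) (h : Eq148PrintedFixedA A B) :
    Eq148DUniform A B := by
  intro Bτ
  obtain ⟨C, hC⟩ := h Bτ ((B - 1 / 2) / 2) (by linarith)
  refine ⟨(B - 1 / 2) / 2, by linarith, C, hC.mono fun D _ χ _ _ hDχ hA κs as h1 h2 => ?_⟩
  have key := hDχ hA κs as h1 h2
  have hexp : (1 / 2 - B + (B - 1 / 2) / 2 : ℝ) = -((B - 1 / 2) / 2) := by ring
  rw [hexp] at key
  exact key

/-- **E-023 «E8-Rankin-retune» (alias ell-E5), one-line bookkeeping.**  Census E8 ((15.20), (16.13)–(16.14)):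
the Rankin truncation `n₁ < T` with `𝔮 = ∏_{q<D⁴} q` fails as printed at `T = D^B` (every `n₁ ≤ T` is
`D⁴`-smooth for `B < 4`); re-tuned cutoff `𝔮 = ∏_{q<D^γ} q` with `γ = γ(D) → 0`, `γ𝓛 → ∞`, `B/γ → ∞` (Dickman
decay), at the price of E9's `D^{−c} ↦ D^{−cγ}`.  At fixed exponents the admissible re-tunes are `0 < γ < B`
(the `o(1)` limit taken along `D`); no floor in `A`.  Price S. [cite: Zhang2022LandauSiegel, §15 (15.20), tex L4244–L4257; §16 (16.13)–(16.14)] -/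
def E8RankinRetune (B γ : ℝ) : Prop := 0 < γ ∧ γ < B

/-- **E-024 «E5-split-retune» (alias ell-E6), one-line bookkeeping.**  Census E5: the split point of the two
ranges of (14.8) is moved from `D³` to `D^{2c}𝓛^{877}` (above it the large sieve wins in any regime), so the
Lemma 5.6 range of `TNeeds` is `rExp = 2c` (up to `o(1)`), `c > 0` the target exponent of (14.8); no floor in
`A` beyond (T5).  Price S. [cite: Zhang2022LandauSiegel, §14 (14.8) (proof) p.79, tex L3962] -/
def E5SplitRetune (c : ℝ) (need : TNeeds) : Prop := 0 < c ∧ need.rExp = 2 * c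

end Printed148

/-! ## §5 The (T7) clause of E-026 PROVED from E-008 and the floor inequality (v3) -/

/-- Monotonicity of the zero-free shape: a narrower region (smaller width, lower height) is implied
(bookkeeping over the shape of Lemma 5.5). [cite: Zhang2022LandauSiegel, §5 Lemma 5.5] -/
theorem ChiZeroFreeAt.mono {D : ℕ} [NeZero D] {χ : DirichletCharacter ℂ D} {w w' H H' : ℝ}
    (h : ChiZeroFreeAt χ w H) (hw : w' ≤ w) (hH : H' ≤ H) : ChiZeroFreeAt χ w' H' := by
  obtain ⟨ρt, hz, huniq⟩ := h
  exact ⟨ρt, hz, fun s hs hre hhalf him => huniq s hs (by linarith) hhalf (lt_of_lt_of_le him hH)⟩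

/-- The real-variable heart of the (T7) floor: with `L = log D`, `λ = (0.72·L^2022)⁻¹` and height
`log T = t·L`, the explicit width `dhWidth 10 1 107 (1/16) λ L (tL) = log(0.045·L^2022/(aL+107))/(aL+107)`,
`a = 10 + t`, dominates `C·log L/(B·L)` for all large `L` as soon as `C·(10+t) < 2021·B` (elementary
asymptotics of the explicit zero-free region (1.2) of Benli–Goel–Twiss–Zaman with `1 − β₁ ≤ (0.72·𝓛^2022)⁻¹`).
[cite: BenliGoelTwissZaman2025, Corollary 1.1 (1.2)] -/
theorem dhWidth_eventually_ge {C t B : ℝ} (ht : 0 < t) (hB : 0 < B) (h : C * (10 + t) < 2021 * B) :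
    ∃ L₀ : ℝ, 1 ≤ L₀ ∧ ∀ L : ℝ, L₀ ≤ L →
      C * Real.log L / (B * L) ≤ dhWidth 10 1 107 (1 / 16) ((0.72 * L ^ 2022)⁻¹) L (t * L) := by
  -- constants
  set a : ℝ := 10 + t with ha_def
  have ha : 0 < a := by rw [ha_def]; linarith
  set c₀ : ℝ := Real.log (a + 107) - Real.log 0.045 with hc₀_def
  have hc₀ : 0 < c₀ := by
    have h1 : 0 < Real.log (a + 107) := Real.log_pos (by linarith)
    have h2 : Real.log 0.045 < 0 := Real.log_neg (by norm_num) (by norm_num)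
    rw [hc₀_def]; linarith
  set κ : ℝ := 2021 * B - C * a with hκ_def
  have hκ : 0 < κ := by rw [hκ_def, ha_def]; linarith
  set M : ℝ := B * c₀ + 107 * |C| with hM_def
  have hM : 0 ≤ M := by rw [hM_def]; positivity
  refine ⟨max 1 (Real.exp (M / κ)), le_max_left _ _, fun L hL => ?_⟩
  have hL1 : 1 ≤ L := le_trans (le_max_left _ _) hL
  have hL0 : 0 < L := by linarith
  have hexp : Real.exp (M / κ) ≤ L := le_trans (le_max_right _ _) hL
  have hlog0 : 0 ≤ Real.log L := Real.log_nonneg hL1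
  have hlogL : M / κ ≤ Real.log L := (Real.le_log_iff_exp_le hL0).mpr hexp
  have hκlog : M ≤ κ * Real.log L := by
    have := (div_le_iff₀ hκ).mp hlogL
    linarith [mul_comm (Real.log L) κ]
  -- the denominator `K = aL + 107`
  have hK : dhK 10 1 107 L (t * L) = a * L + 107 := by rw [dhK, ha_def]; ring
  have hKpos : 0 < a * L + 107 := by positivity
  have hKle : a * L + 107 ≤ (a + 107) * L := by nlinarith
  -- the numerator
  have hpow : 0 < L ^ 2022 := by positivity
  have harg : 1 / 16 / ((0.72 * L ^ 2022)⁻¹ * (a * L + 107)) = 0.045 * L ^ 2022 / (a * L + 107) := by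
    field_simp
    ring
  have hnum : 2021 * Real.log L - c₀ ≤ Real.log (0.045 * L ^ 2022 / (a * L + 107)) := by
    rw [Real.log_div (by positivity) hKpos.ne', Real.log_mul (by norm_num) hpow.ne', Real.log_pow]
    have hlogK : Real.log (a * L + 107) ≤ Real.log (a + 107) + Real.log L := by
      rw [← Real.log_mul (by positivity) hL0.ne']
      exact Real.log_le_log hKpos hKle
    rw [hc₀_def]
    push_cast
    linarith
  -- assemble
  unfold dhWidth
  rw [hK, harg]
  refine le_trans ?_ (div_le_div_of_nonneg_right hnum hKpos.le)
  rw [div_le_div_iff₀ (by positivity) hKpos]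
  have h1 : M * L ≤ κ * Real.log L * L := mul_le_mul_of_nonneg_right hκlog hL0.le
  have hlogle : Real.log L ≤ L := by linarith [Real.log_le_sub_one_of_pos hL0]
  have h2 : C * Real.log L ≤ |C| * L :=
    (mul_le_mul_of_nonneg_right (le_abs_self C) hlog0).trans
      (mul_le_mul_of_nonneg_left hlogle (abs_nonneg C))
  rw [hM_def] at h1
  rw [hκ_def, ha_def] at h1
  nlinarith [h1, h2]


/-- **The (T7) clause of E-026 is a kernel theorem GIVEN E-008 and the numeric floor inequality.**
From `chiZeroFreeAt_explicit` (BGTZ Cor. 1.1 + Lemma 2.9 = registry E-008, typed named facts) and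
`dhWidth_eventually_ge`: for every `B > 0` and every need with `tExp7 > 0` and
`E7FloorIneq need B` (`C7·(10 + tExp7) < 2021·B`), for all large `D` and every real primitive `χ (mod D)`
with (A), `L(s,χ)` has no zero other than its exceptional one in `Re s > 1 − C7·log 𝓛/(B𝓛)`, `Re s > 1/2`,
`|Im s| < D^{tExp7}` — the (T7) conjunct of `TFloorsAt need A B` (it does not depend on `A` or on the
scale record).  The HEURISTIC closed form `E7FloorIneq` of v1 is thereby the EXACT asymptotic condition
delivered by the explicit inputs (sufficient; the derivation «routine asymptotics» of the v1 docstring, now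
in the tree). [cite: BenliGoelTwissZaman2025, Corollary 1.1, Lemma 2.9] [cite: Zhang2022LandauSiegel, §5 Lemma 5.5; §8 Lemma 8.4] -/
theorem chiZeroFreeAt_T7_of_e7FloorIneq (h11 : BGTZ2025.corollary11) (h29 : BGTZ2025.lemma29)
    (need : TNeeds) {B : ℝ} (hB : 0 < B) (ht : 0 < need.tExp7) (h7 : E7FloorIneq need B) :
    ForAllLarge fun D _ χ => AssumptionA D χ →
      ChiZeroFreeAt χ (need.C7 * Real.log (Real.log D) / (B * Real.log D)) ((D : ℝ) ^ need.tExp7) := by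
  obtain ⟨L₀, -, hL₀⟩ := dhWidth_eventually_ge ht hB h7
  set L₁ : ℝ := max L₀ (max 1 (Real.log 4 / need.tExp7)) with hL₁_def
  refine ((chiZeroFreeAt_explicit h11 h29).and
    (ForAllLarge.of_le (S := fun D _ _ => ⌈Real.exp L₁⌉₊ ≤ D) ⌈Real.exp L₁⌉₊
      fun D _ χ hD _ _ => hD)).mono fun D _ χ _ _ hboth hA => ?_
  obtain ⟨hfree, hD⟩ := hboth
  have hDexp : Real.exp L₁ ≤ D := le_trans (Nat.le_ceil _) (by exact_mod_cast hD)
  have hDpos : (0 : ℝ) < D := lt_of_lt_of_le (Real.exp_pos _) hDexp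
  have hlogD : L₁ ≤ Real.log D := (Real.le_log_iff_exp_le hDpos).mpr hDexp
  have hL₀D : L₀ ≤ Real.log D := le_trans (le_max_left _ _) hlogD
  have h1D : 1 ≤ Real.log D := le_trans (le_trans (le_max_left _ _) (le_max_right _ _)) hlogD
  have h4D : Real.log 4 / need.tExp7 ≤ Real.log D :=
    le_trans (le_trans (le_max_right _ _) (le_max_right _ _)) hlogD
  -- the height `T = D^{tExp7} ≥ 4`
  have h4 : (4 : ℝ) ≤ (D : ℝ) ^ need.tExp7 := by
    have hle : Real.log 4 ≤ Real.log D * need.tExp7 := by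
      rw [div_le_iff₀ ht] at h4D
      linarith
    calc (4 : ℝ) = Real.exp (Real.log 4) := (Real.exp_log (by norm_num)).symm
      _ ≤ Real.exp (Real.log D * need.tExp7) := Real.exp_le_exp.mpr hle
      _ = (D : ℝ) ^ need.tExp7 := (Real.rpow_def_of_pos hDpos _).symm
  have key := hfree hA _ h4
  rw [Real.log_rpow hDpos] at key
  refine key.mono ?_ le_rfl
  have := hL₀ (Real.log D) hL₀D
  unfold lamA
  exact this

/-- **E-026 at `(A,B)` from its (T5) half alone** (GIVEN E-008 and `E7FloorIneq need B`, `B > 0`,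
`tExp7 > 0`): the (T7) conjunct is supplied by `chiZeroFreeAt_T7_of_e7FloorIneq`, so the registry row
«T-floors-explicit» reduces to the (T5) clause — Lemma 5.6 at free scale with saving `𝓛^{−C5}` (an explicit
prime-number theorem for twisted prime sums under the Deuring–Heilbronn region; B-dh's chain, NOT here).
[cite: Zhang2022LandauSiegel, §5 Lemmas 5.5–5.6; §14 (14.8) proof p.79] [cite: BenliGoelTwissZaman2025, Corollary 1.1] -/
theorem tFloorsAt_of_e7FloorIneq (h11 : BGTZ2025.corollary11) (h29 : BGTZ2025.lemma29)
    (need : TNeeds) {A B : ℝ} (hB : 0 < B) (ht : 0 < need.tExp7) (h7 : E7FloorIneq need B)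
    (h5 : ForAllLarge fun D _ χ => AssumptionA D χ → ∀ S : Scales, S.D = D → S.IsEllRegime A B →
      Lemma56At S χ need.rExp need.tExp5 (Real.log D ^ (-need.C5))) :
    TFloorsAt need A B :=
  (h5.and (chiZeroFreeAt_T7_of_e7FloorIneq h11 h29 need hB ht h7)).mono
    fun _ _ _ _ _ hboth hA S hSD hreg => ⟨hboth.1 hA S hSD hreg, hboth.2 hA⟩

/-- The floor inequality is monotone in `B` (a longer `T` only helps (T7)).
[cite: Zhang2022LandauSiegel, §8 Lemma 8.4] -/
theorem e7FloorIneq_mono (need : TNeeds) {B B' : ℝ} (hBB' : B ≤ B') (h : E7FloorIneq need B) :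
    E7FloorIneq need B' := by
  unfold E7FloorIneq at *
  linarith

/-- **E-026 as a floor along the tie `B = τA`, from the (T5) half** (GIVEN E-008): if `τ > 0`, `A₀T > 0`,
`tExp7 > 0`, the (T7) inequality holds at the floor (`E7FloorIneq need (τ·A₀T)`, i.e.
`A₀T > C7(10+tExp7)/(2021τ)` — the second branch of `aZeroT`), and the (T5) clause holds at every
`A ≥ A₀T`, then `TFloorsFrom need τ A₀T`. [cite: Zhang2022LandauSiegel, §2 (2.21); §5 Lemmas 5.5–5.6; §14 (14.8) proof p.79] -/
theorem tFloorsFrom_of_e7FloorIneq (h11 : BGTZ2025.corollary11) (h29 : BGTZ2025.lemma29)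
    (need : TNeeds) {τ A₀T : ℝ} (hτ : 0 < τ) (hA₀T : 0 < A₀T) (ht : 0 < need.tExp7)
    (h7 : E7FloorIneq need (τ * A₀T))
    (h5 : ∀ A : ℝ, A₀T ≤ A → ForAllLarge fun D _ χ => AssumptionA D χ → ∀ S : Scales, S.D = D →
      S.IsEllRegime A (τ * A) → Lemma56At S χ need.rExp need.tExp5 (Real.log D ^ (-need.C5))) :
    TFloorsFrom need τ A₀T := fun A hA =>
  tFloorsAt_of_e7FloorIneq h11 h29 need (mul_pos hτ (lt_of_lt_of_le hA₀T hA)) ht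
    (e7FloorIneq_mono need (mul_le_mul_of_nonneg_left hA hτ.le) h7) (h5 A hA)

/-- **Registry orientation arithmetic, exact** (HEURISTIC need values `tExp7 = 1`, `C7 = 15`, tie
`τ = 3·10⁻⁴`, of record nowhere as the values of `TNeeds`): along `B = 3·10⁻⁴·A` the (T7) floor inequality is
EXACTLY `A > 1650000/6063 ≈ 272.14`. [cite: Zhang2022LandauSiegel, §2 (2.21); §8 Lemma 8.4] -/
theorem e7FloorIneq_orientation_iff (need : TNeeds) (h1 : need.tExp7 = 1) (h15 : need.C7 = 15) (A : ℝ) :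
    E7FloorIneq need (3 / 10000 * A) ↔ (1650000 / 6063 : ℝ) < A := by
  unfold E7FloorIneq
  rw [h1, h15]
  constructor <;> intro h <;> linarith

end Literature.NumberTheory.LFunctions.Zhang2022.EllRegime

end
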